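import Literature.AnabelianGeometry.AbsoluteAnabelian.LogFrobeniusPanalocalizationCoherenceIdentity
import Literature.AnabelianGeometry.AbsoluteAnabelian.DiagramMorphismPathIso
import Literature.AnabelianGeometry.AbsoluteAnabelian.LogFrobeniusRigidityProofs
import Literature.AnabelianGeometry.AbsoluteAnabelian.LogFrobeniusShiftActionOfRealises
import Literature.AnabelianGeometry.AbsoluteAnabelian.LogFrobeniusCor55FamiliesDiagonal
import HarnessLib

/-!
# [AbsTopIII] Cor 5.5 (vi) AT THE IDENTITY PANALOCALIZATION: the first producer of `Cor55Panalocalization` (F-3140)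

S. Mochizuki, *Topics in Absolute Anabelian Geometry III*, Cor 5.5 (vi) p. 132 (manuscript `paper:url-5493eb38cbb7`):
"the panalocalization morphism `D⊚⊢ → D✠⊢` … is compatible with the cores of (i), the telecore and contact structures of
(ii), the observables of (iii), and the `ℤ`-actions of (v)".  The cell file `LogFrobeniusPanalocalization.lean`
(abc-iut-L4-t3) types this as the assumption `Panalocalization.Cor55Panalocalization P :=
P.CompatibleWithFamilies ∧ P.CompatibleWithTelecoreData ∧ P.CompatibleWithShifts` on a panalocalization `P` of
log-Frobenius settings (FACT-LIST F-3140; node AbsTopIII:Cor5.5(vi), cone bucket = fact), which until now had NO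
producer in the tree (census «L4-LABEL-7 K4 CENSUS», abc-iut-L4-t8 gen 12).

PROOF-ONLY file (no `def`, no instance, no new `Prop` fact).  At the IDENTITY panalocalization `identity L : L → L`
(`LogFrobeniusPanalocalizationIdentityTelecore.lean`; print's case `D⊚ = D✠`, §0 "panalocalization of the identity")
of ANY setting `L`:
* `identity_iso_eq_eqToIso` — every 2-cell of the 1-morphism `(identity L).hom` is an `eqToIso` (its vertex functors
  are identity functors and its 2-cells unitor composites);
* `identity_compatibleWith_self` — Def 3.5 (v)-compatibility of `(identity L).hom` with `(K, K)` for EVERY family of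
  homotopies `K` on `D•⊢` (the `Φ_{[γ]}` have `eqToHom` components, `DiagramMorphismPathIso` toolkit);
* `identity_compatibleWithFamilies_of_realises` — conjunct 1 from ONE realising family (F-0159 `RealisesCor55Families`,
  the printed hypothesis "the cores of (i), the observables of (iii)"; its universal closure is refuted at twisted
  settings, `LogFrobeniusCrossPlaceObstruction`, so the binder is necessary-shaped);
* `identity_compatibleWithShifts` — conjunct 3 UNCONDITIONALLY (`shift ∘ id ≅ id ∘ shift`, both strictly commuting,
  via abc-iut-w5-d112's `OneMorphism.transport_isomorphic`);
* conjunct 2 is abc-iut's landed `identity_compatibleWithTelecoreData`;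
* ★ `cor55Panalocalization_identity_of_realises (hK : L.RealisesCor55Families K) : (identity L).Cor55Panalocalization`,
  and the same from F-0157 `Cor55ShiftAction L` (abc-iut-f's `cor55ShiftAction_iff_exists_realisesCor55Families`);
* ★ ZERO-BINDER COROLLARY `cor55Panalocalization_identity_diagonal` at the one carrier of record that PRODUCES
  `RealisesCor55Families` with zero binders — abc-iut-L4's DIAGONAL calibration setting `diagonal Vmod isArc C`
  (`diagonal_realisesCor55Families`, `V(F_mod) ≠ ∅`): F-3140 is INHABITED (degenerate-calibration carrier, honest label).
HONEST LABEL: an INSTANCE at the identity panalocalization, K-conditional on F-0159; not the printed statement for a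
genuine `D⊚ → D✠`; nothing here bears on [IUTchIII] Cor 3.12; no side taken.
-/

set_option autoImplicit false

noncomputable section

universe u

open CategoryTheory Quiver

namespace Literature.AnabelianGeometry.AbsoluteAnabelian

/-! ### `eqToHom` bookkeeping (local copies of the folklore helpers of `LogFrobeniusRigidityProofs`) -/

section EqToHomCalculus

variable {C : Type*} [Category C] {C' : Type*} [Category C']

/-- an identity is an `eqToHom`. [folklore] -/
private theorem exists_eq_eqToHom_id' (X : C) : ∃ h : X = X, 𝟙 X = eqToHom h := ⟨rfl, rfl⟩

/-- a composite of two `eqToHom`s is an `eqToHom`. [folklore] -/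
private theorem exists_eq_eqToHom_comp' {X Y Z : C} {f : X ⟶ Y} {g : Y ⟶ Z} (hf : ∃ h, f = eqToHom h)
    (hg : ∃ h, g = eqToHom h) : ∃ h, f ≫ g = eqToHom h := by
  obtain ⟨p, rfl⟩ := hf
  obtain ⟨q, rfl⟩ := hg
  exact ⟨p.trans q, eqToHom_trans p q⟩

/-- a functor maps an `eqToHom` to an `eqToHom`. [folklore] -/
private theorem exists_eq_eqToHom_map' (G : C ⥤ C') {X Y : C} {f : X ⟶ Y} (hf : ∃ h, f = eqToHom h) :
    ∃ h, G.map f = eqToHom h := by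
  obtain ⟨p, rfl⟩ := hf
  exact ⟨congrArg G.obj p, eqToHom_map G p⟩

/-- a component of an `eqToIso` between functors is an `eqToHom`. [folklore] -/
private theorem exists_eq_eqToHom_app' {A : Type*} [Category A] {F G : A ⥤ C} {i : F ≅ G}
    (hi : ∃ H, i = eqToIso H) (X : A) : ∃ h, i.hom.app X = eqToHom h := by
  obtain ⟨p, rfl⟩ := hi
  exact ⟨Functor.congr_obj p X, by rw [eqToIso.hom, eqToHom_app]⟩

/-- a natural isomorphism all of whose components are `eqToHom`s is an `eqToIso`. [folklore] -/
private theorem exists_eq_eqToIso_of_app {A : Type*} [Category A] {F G : A ⥤ C} (i : F ≅ G)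
    (h : ∀ X, ∃ hX, i.hom.app X = eqToHom hX) : ∃ H, i = eqToIso H := by
  have hobj : ∀ X, F.obj X = G.obj X := fun X => (h X).choose
  have happ : ∀ X, i.hom.app X = eqToHom (hobj X) := fun X => (h X).choose_spec
  have H : F = G := Functor.ext_of_iso i hobj happ
  refine ⟨H, ?_⟩
  ext X
  rw [happ, eqToIso.hom, eqToHom_app]

/-- `f ≫ eqToHom = eqToHom ≫ g` from `HEq f g`. [folklore] -/
private theorem comp_eqToHom_eq_eqToHom_comp_of_heq' {X Y X' Y' : C} {f : X ⟶ Y} {g : X' ⟶ Y'}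
    (h₁ : X = X') (h₂ : Y = Y') (H : HEq f g) : f ≫ eqToHom h₂ = eqToHom h₁ ≫ g := by
  subst h₁ h₂
  cases H
  rw [eqToHom_refl, eqToHom_refl, Category.comp_id, Category.id_comp]

end EqToHomCalculus

namespace Panalocalization

open DiagramOfCategories LogFrobeniusSetting

variable {Vmod : Type u} {isArc : Vmod → Bool} (L : LogFrobeniusSetting Vmod isArc)

/-! ### The 1-morphism of the identity panalocalization commutes strictly -/

/-- the vertex functors of the identity panalocalization are identity functors (heterogeneously).
[cite: MochizukiAbsTopIII2015, Cor 5.5 (vi) p. 132] -/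
theorem identity_app_heq_id (a : DVertex Vmod isArc) : HEq ((identity L).hom.app a) (𝟭 (a.category L)) := by
  cases a <;> exact HEq.rfl

/-- … so they do not move objects … [cite: MochizukiAbsTopIII2015, Cor 5.5 (vi) p. 132] -/
theorem identity_app_obj (a : DVertex Vmod isArc) (x : L.diagram.obj a) : ((identity L).hom.app a).obj x = x := by
  cases a <;> rfl

/-- … nor morphisms (heterogeneously). [cite: MochizukiAbsTopIII2015, Cor 5.5 (vi) p. 132] -/
theorem identity_app_map_heq (a : DVertex Vmod isArc) {x y : L.diagram.obj a} (m : x ⟶ y) :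
    HEq (((identity L).hom.app a).map m) m := by
  cases a <;> exact HEq.rfl

/-- every 2-cell of the 1-morphism `(identity L).hom : D• → D•` is an `eqToIso` (all are unitor composites at
identity functors). [cite: MochizukiAbsTopIII2015, Cor 5.5 (vi) p. 132] -/
theorem identity_iso_eq_eqToIso {a b : DVertex Vmod isArc} (e : a ⟶ b) :
    ∃ H, (identity L).hom.iso e = eqToIso H := by
  refine exists_eq_eqToIso_of_app _ fun x => ?_
  cases e <;> dsimp [Panalocalization.hom, Panalocalization.iso, Panalocalization.identity] <;>
    exact exists_eq_eqToHom_comp' (exists_eq_eqToHom_id' _) (exists_eq_eqToHom_id' _)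

/-! ### Conjunct 1: compatibility with families of homotopies -/

/-- homotopies of a family at propositionally equal boundary pairs have heterogeneously equal components at
propositionally equal objects. [folklore] -/
private theorem eta_app_heq (K : L.diagram.HomotopyFamily) {a b : DVertex Vmod isArc} {p p' q q' : Path a b}
    (hp : p' = p) (hq : q' = q) (h : K.E p q) (h' : K.E p' q') {x y : L.diagram.obj a} (hxy : y = x) :
    HEq ((K.η h').app y) ((K.η h).app x) := by
  subst hp hq hxy
  rfl

/-- **Def 3.5 (v): the identity panalocalization is compatible with `(K, K)` for EVERY family of homotopies `K` on
`D•⊢`** — boundary sets correspond by `(𝟭).mapPath p = p`, and, all 2-cells of `(identity L).hom` being `eqToIso`s, its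
`Φ_{[γ]}` have `eqToHom` components, so the compatibility square of the homotopies commutes.
[cite: MochizukiAbsTopIII2015, Definition 3.5 (v) p.76] -/
theorem identity_compatibleWith_self (K : L.diagram.HomotopyFamily) :
    Nonempty ((identity L).hom.CompatibleWith K K) := by
  refine ⟨{ pathIso := fun p => (identity L).hom.pathIso p
            pathIso_nil := fun a => OneMorphism.pathIso_nil _ a
            pathIso_cons := fun p e => OneMorphism.pathIso_cons _ p e
            boundary_iff := fun p q => by rw [Prefunctor.mapPath_id, Prefunctor.mapPath_id]; exact Iff.rfl
            boundary_surj := fun p' q' _ => ⟨p', q', Prefunctor.mapPath_id p', Prefunctor.mapPath_id q'⟩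
            η_compat := fun {a b} p q h => ?_ }⟩
  ext x
  obtain ⟨h₁, h₂, e₁, e₂⟩ := OneMorphism.exists_pathIso_hom_app_eq (identity L).hom
    (fun e => identity_iso_eq_eqToIso L e) p q x
  rw [NatTrans.comp_app, NatTrans.comp_app, Functor.whiskerLeft_app, Functor.whiskerRight_app, e₁, e₂]
  refine comp_eqToHom_eq_eqToHom_comp_of_heq' h₁ h₂ ?_
  exact (eta_app_heq L K (Prefunctor.mapPath_id p) (Prefunctor.mapPath_id q) h _ (identity_app_obj L a x)).trans
    (identity_app_map_heq L b _).symm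

/-- **Cor 5.5 (vi), "compatible with the cores of (i) [and] the observables of (iii)", AT THE IDENTITY** — from ONE family
of homotopies realising them (F-0159 `RealisesCor55Families`, the printed hypothesis): `CompatibleWithFamilies` with
`K₁ = K₂ = K`. [cite: MochizukiAbsTopIII2015, Cor 5.5 (vi) p. 132] -/
theorem identity_compatibleWithFamilies_of_realises {K : L.diagram.HomotopyFamily} (hK : L.RealisesCor55Families K) :
    (identity L).CompatibleWithFamilies :=
  ⟨K, K, hK, hK, identity_compatibleWith_self L K⟩

/-! ### Conjunct 3: compatibility with the `ℤ`-actions -/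

/-- a composite of two strictly commuting 1-morphisms commutes strictly: its 2-cells are `eqToIso`s.
[cite: MochizukiAbsTopIII2015, Definition 3.5 (v) p.76] -/
theorem _root_.Literature.AnabelianGeometry.AbsoluteAnabelian.DiagramOfCategories.OneMorphism.comp_iso_eq_eqToIso
    {V : Type u} [Quiver.{u} V] {F G : V ⥤q V}
    {D : DiagramOfCategories.{u, u + 1, u} V} (Φ : OneMorphism F D D) (Ψ : OneMorphism G D D)
    (hΦ : ∀ {a b : V} (e : a ⟶ b), ∃ H, Φ.iso e = eqToIso H)
    (hΨ : ∀ {a b : V} (e : a ⟶ b), ∃ H, Ψ.iso e = eqToIso H) {a b : V} (e : a ⟶ b) :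
    ∃ H, (Φ.comp Ψ).iso e = eqToIso H := by
  refine exists_eq_eqToIso_of_app _ fun x => ?_
  dsimp [OneMorphism.comp]
  exact exists_eq_eqToHom_comp' (exists_eq_eqToHom_id' _)
    (exists_eq_eqToHom_comp' (exists_eq_eqToHom_app' (hΨ (F.map e)) _)
      (exists_eq_eqToHom_comp' (exists_eq_eqToHom_id' _)
        (exists_eq_eqToHom_comp' (exists_eq_eqToHom_map' _ (exists_eq_eqToHom_app' (hΦ e) x))
          (exists_eq_eqToHom_id' _))))

/-- **Cor 5.5 (vi), "compatible with the `ℤ`-actions of (v)", AT THE IDENTITY — UNCONDITIONAL**: `⋎+k ∘ id ≅ id ∘ ⋎+k`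
as 1-morphisms over `⋎ ↦ ⋎ + k` (both composites have identity vertex functors and `eqToIso` 2-cells;
abc-iut-w5-d112's `OneMorphism.transport_isomorphic`). [cite: MochizukiAbsTopIII2015, Cor 5.5 (vi) p. 132] -/
theorem identity_compatibleWithShifts : (identity L).CompatibleWithShifts := by
  intro k
  have happ : ∀ a, HEq (((L.shiftOneMorphism k).comp (identity L).hom).app a)
      (((identity L).hom.comp (L.shiftOneMorphism k)).app a) := by
    intro a
    cases a <;> exact HEq.rfl
  exact OneMorphism.transport_isomorphic _ _ rfl happ
    (fun e => OneMorphism.comp_iso_eq_eqToIso _ _ (fun e => L.shiftOneMorphism_iso_eq k e)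
      (fun e => identity_iso_eq_eqToIso L e) e)
    (fun e => OneMorphism.comp_iso_eq_eqToIso _ _ (fun e => identity_iso_eq_eqToIso L e)
      (fun e => L.shiftOneMorphism_iso_eq k e) e)

/-! ### Assembly -/

/-- ★ **[AbsTopIII] Cor 5.5 (vi) AT THE IDENTITY PANALOCALIZATION (first producer of F-3140 `Cor55Panalocalization`)**:
for every log-Frobenius setting `L` and every family of homotopies `K` on `D•⊢` realising the cores of Cor 5.5 (i) and
the observables of (iii) (F-0159), the identity panalocalization `D• → D•` "is compatible with the cores of (i), the
telecore and contact structures of (ii), the observables of (iii), and the `ℤ`-actions of (v)" in the typed sense.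
HONEST LABEL: instance at `D⊚ = D✠`, K-conditional on F-0159; not the genuine `D⊚ → D✠` statement.
[cite: MochizukiAbsTopIII2015, Cor 5.5 (vi) p. 132] -/
theorem cor55Panalocalization_identity_of_realises {K : L.diagram.HomotopyFamily} (hK : L.RealisesCor55Families K) :
    (identity L).Cor55Panalocalization :=
  ⟨identity_compatibleWithFamilies_of_realises L hK, identity_compatibleWithTelecoreData L, identity_compatibleWithShifts L⟩

/-- ★ the same from **F-0157 `Cor55ShiftAction L`** ("the `ℤ`-action of Cor 5.5 (v)"), which is equivalent to the
existence of a realising family (`cor55ShiftAction_iff_exists_realisesCor55Families`).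
[cite: MochizukiAbsTopIII2015, Cor 5.5 (vi) p. 132] -/
theorem cor55Panalocalization_identity_of_cor55ShiftAction (h : L.Cor55ShiftAction) :
    (identity L).Cor55Panalocalization := by
  obtain ⟨K, hK⟩ := L.cor55ShiftAction_iff_exists_realisesCor55Families.mp h
  exact cor55Panalocalization_identity_of_realises L hK

/-- ★ **ZERO-BINDER INSTANCE of F-3140**: at abc-iut-L4's DIAGONAL calibration setting `diagonal Vmod isArc C` (`𝒳 = C`
any large category, every functor an identity; `V(F_mod) ≠ ∅`), whose strict-commutation family realises the Cor 5.5
(i)/(iii) families with zero binders (`diagonal_realisesCor55Families`), the identity panalocalization satisfies the typed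
Cor 5.5 (vi).  DEGENERATE-CALIBRATION carrier (honest label): shows `Cor55Panalocalization` is inhabited, not that a
genuine `D⊚ → D✠` satisfies it. [cite: MochizukiAbsTopIII2015, Cor 5.5 (vi) p. 132] -/
theorem cor55Panalocalization_identity_diagonal (Vmod : Type u) (isArc : Vmod → Bool) [Nonempty Vmod]
    (C : Type (u + 1)) [Category.{u} C] :
    (identity (LogFrobeniusSetting.diagonal Vmod isArc C)).Cor55Panalocalization :=
  cor55Panalocalization_identity_of_realises _ (LogFrobeniusSetting.diagonal_realisesCor55Families Vmod isArc C)

/-- … hence `Cor55Panalocalization` is INHABITED over every nonempty index set: some panalocalization between some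
settings satisfies it. [cite: MochizukiAbsTopIII2015, Cor 5.5 (vi) p. 132] -/
theorem exists_cor55Panalocalization (Vmod : Type u) (isArc : Vmod → Bool) [Nonempty Vmod] :
    ∃ (L : LogFrobeniusSetting Vmod isArc) (P : Panalocalization L L), P.Cor55Panalocalization :=
  ⟨_, _, cor55Panalocalization_identity_diagonal Vmod isArc (Type u)⟩

/-- … packaged as an existence statement over the setting: some panalocalization `L → L` satisfies the typed Cor 5.5 (vi)
whenever the cores/observables of Cor 5.5 (i)/(iii) are realised. [cite: MochizukiAbsTopIII2015, Cor 5.5 (vi) p. 132] -/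
theorem exists_self_cor55Panalocalization_of_realises {K : L.diagram.HomotopyFamily} (hK : L.RealisesCor55Families K) :
    ∃ P : Panalocalization L L, P.panT = 𝟭 _ ∧ P.Cor55Panalocalization :=
  ⟨identity L, rfl, cor55Panalocalization_identity_of_realises L hK⟩

end Panalocalization

end Literature.AnabelianGeometry.AbsoluteAnabelian

end
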